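import Summits.AtomisticToContinuum.Crystallization.Theorems.ChargedEnergyGapNonAffineExchangeA
import HarnessLib

/-!
# ChargedEnergyGap · NODE 70 «NonAffineExchange», part B (lens-3 g70): the glue (PROVED), the sanity instances, the Korn corner, the record cones

Part B of two.  §X3 THE GLUE `coerciveStiffCls_of_barExch_of_geoExch` (PROVED, four lines: add the two inequalities, `η·nonAffL` cancels,
`stiffL = barL + geoL` by NODE 69's `stiffL_eq_barL_add_geoL` under the block's `SmallStrain`), its unequal-rate form (`η_GEO ≤ η_BAR`,
`coerciveStiffCls_of_barExch_of_geoExch_le`), NODE 69's glue recovered through the `η = 0` slices (an `example`: the statement is the landed `coerciveStiffCls_of_bar_of_geo`),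
and the SANITY instances: the conclusion of [BAR♮-ᶜ] holds for every rotation cocycle at every reference WITH every excision (all three functionals
vanish), the conclusion of [GEO♮-ᶜ] holds for rotations and for EVERY AFFINE FIELD at every site-stress-free reference (no excision) with every
`ν₀ ≥ 0` and every `η`; on affine fields the [BAR♮-ᶜ] conclusion IS the [BAR-ᶜ] conclusion (`barExch_conclusion_affineField_iff`: the affine
stability content [A-i]/(T)/(C11) asked of the bar piece is NODE 69's, unchanged).
§X4 THE KORN CORNER — g69's booked target 3 «[GEO] ⟸ [GEO-grad] ∧ [KORN-loc]» TYPED through the exchange: [KORN-ᶜ](`C_K`) `NonAffKornCls`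
(`nonAffL ≤ C_K·springL + currencies`, a finite cluster-truss rigidity certificate: two-step octet chunks are first-order rigid with affine flex
space; the bare cuboctahedral star is not — jitterbug) and the two conversions `geoStiffCls_of_geoExch_of_korn` ([GEO♮](`ν₀, η`) ∧ [KORN](`C_K`) ⟹
[GEO](`ν₀ + η·C_K`)) / `barExchCls_of_bar_of_korn` ([BAR](`μ₁ + η·C_K`) ∧ [KORN] ⟹ [BAR♮](`μ₁, η`)), both PROVED, both LOSSY by the floats
(`C_K^Bloch = 6.00ᶠ (L) | 6.66ʰ (optical Γ)`: at the designate rates `η·C_K = 0.24 | 0.17` of modulus, i.e. `ν ≈ 0.39 | 0.37` vs the direct ceiling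
`0.23 | 0.26`) — RECORDED as the alternative for a prover who prefers a finite rigidity certificate on the prestress side, NOT in the designate cone.
§X5 RECORD CONES (R5): PARAMETRIC one-class (`localSeamTransferBoundCls_record_of_load_barExch_geoExch`: [LOAD-ᶜ](`(μ₁−ν₀)/2`) ∧ [BAR♮-ᶜ] ∧ [GEO♮-ᶜ]
⟹ (H𝄪ᶜ)@rec for every budget split and every `(μ₁, ν₀, η, r₁)`), PARAMETRIC max-cover (`chargedEnergyGap_of_maxCoverExchange_record`), the
DESIGNATE arithmetic `33/20 − 3/20 = 3/2 = 17/10 − 1/5` (`record_exchange_budget`; currencies halved as in NODE 69, `record_stressSplit_budget`),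
the per-class designates `coerciveStiffCls_designateF|H_of_barExch_of_geoExch` — fcc `(μ₁, ν₀, η) = (33/20, 3/20, 1/25)`, hcp `(17/10, 1/5, 1/40)`,
currencies `(1/(30·10⁶), 10⁻⁶)` per piece, `r₁ = 6/5` — and THE RECORD-DESIGNATE OF GENERATION 70 `chargedEnergyGap_of_maxCoverExchange_designate`
(FOURTEEN LEAVES as NODE 69, [BAR-ᶜ] ↦ [BAR♮-ᶜ], [GEO-ᶜ] ↦ [GEO♮-ᶜ] one for one; [LOAD-ᶜ](`3/4`) and every record leaf UNCHANGED), plus three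
POPULATED fcc instances at `Fcc.fccRef Fcc.a0` (`Fcc.isSiteStressFree_fcc`).

FLOATS (pure python, `num/bloch_exchange_fcc.py RC GRID`, `num/bloch_exchange_hcp.py RC NG resolve`; LJ(13-7) `V′ = −t⁻¹³ + t⁻⁷`; Bloch forms per
unit pivot `S` = nn longitudinal springs; `N(k)` = the exact least-squares non-affinity form of a plane wave on the 12-star, Hermitian `6×6` for hcp):
  fcc, cutoff 7 nn (2092 pts, `d₁ = 0.97142`; cutoff 9: 4320 pts, `d₁ = 0.97133`, same digits ±0.001):
    `ν^B = 0.232 @ (0.56,0.56,0)π · μ₁^B = 1.819 · μ^B = 1.818 · max N/S = 6.00 @ L`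
    `η_hi(μ₁)`: 1.50 ↦ 0.137 · 1.60 ↦ 0.121 · 1.65 ↦ 0.112 · 1.70 ↦ 0.104 · 1.75 ↦ 0.096 · 1.80 ↦ 0.087 (argmin L = (½,½,½)π)
    `η_lo(ν₀)`: 0.10 ↦ 0.027 · 0.15 ↦ 0.016 · 0.20 ↦ 0.006 · 0.25 ↦ −0.004 (argmax (1, 0.4, 0.4)π); `ν₀ = 0 ↦ 0.094 → 0.100 →(extrap.) ≈ 0.12` (long-wave tail)
  hcp, cutoff 5 a, RE-SOLVED stress-free cell `a = 0.97179, c/a = 1.6328` (1414 k-pts; cutoff 6: `a = 0.97159`, 494 k-pts, same digits ±0.002):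
    `ν^B = 0.255 @ H · μ₁^B = 1.969 · μ^B = 1.810 · max pencil(N,S) = 6.66 @ optical Γ`
    `η_hi(μ₁)`: 1.60 ↦ 0.070 · 1.65 ↦ 0.061 · 1.70 ↦ 0.053 · 1.75 ↦ 0.044 · 1.80 ↦ 0.035 (argmin optical Γ)
    `η_lo(ν₀)`: 0.10 ↦ 0.027 · 0.15 ↦ 0.018 · 0.20 ↦ 0.010 · 0.25 ↦ 0.001 (argmax H)
  DESIGNATE windows: fcc `η ∈ [0.016, 0.112] ∋ 1/25` (×2.5 / ×2.8), `μ₁ = 33/20` margin `9.3 %`; hcp `η ∈ [0.010, 0.053] ∋ 1/40` (×2.6 / ×2.1),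
  `μ₁ = 17/10` margin `13.7 %`.  Composition loss of NODE 69 (`0.23`) RECOVERED: `μ₁ − ν₀` feasible up to `≈ μ^B`.

CENSUS PRE-REGISTRATION «EXCH-70» (ASK on the bus): certify per class, interval arithmetic, cutoff ≥ 6 nn-distances with the `d⁻⁸` tail bound, at the
cutoff-consistent stress-free cell: (E1) `min_k λ_min(B(k) − μ₁ S(k) − η N(k)) ≥ 0` and (E2) `min_k λ_min(G(k) + ν₀ S(k) + η N(k)) ≥ 0` on a
certified k-mesh + Lipschitz remainder, at the designate triples; kill: a certified negative eigenvalue of (E1) or (E2) at a record reference, or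
`η_lo(ν₀) > η_hi(μ₁)` for every `(μ₁, ν₀)` with `μ₁ − ν₀ ≥ 7/5`.

0 sorry · 0 native_decide · no private / instance / notation · standard axioms · ≤ 400 lines per part.
-/

noncomputable section
open scoped Classical
open Literature.MathematicalPhysics.StatisticalMechanics Literature.Geometry.DiscreteGeometry
open Summit.AtomisticToContinuum.Crystallization.Theses.PricedLinkCensus
open Summit.AtomisticToContinuum.Crystallization.Theorems.ChargedEnergyGapNegative

namespace Summit.AtomisticToContinuum.Crystallization.Theorems.ChargedEnergyGapChartDial

section Glue

variable {cls : Set E3 → Prop} {s lam ℓ μ₀ τ ϱ b₀ r_S ϱχ r₁ : ℝ}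

/-! ## §X3 ★★ The glue (PROVED): the exchange currency cancels -/

/-- ★★ **THE GLUE, PROVED: [BAR♮-ᶜ](`μ₁, η, c′`) ∧ [GEO♮-ᶜ](`ν₀, η, c″`) ⟹ [COER-ᶜ](`μ₁ − ν₀, c′ + c″`)** (same class, same block dials, same spring
range, the SAME exchange rate `η` on both sides) — add the two inequalities: `η·nonAffL` CANCELS, `stiffL = barL + geoL` for the Volterra field by
NODE 69's `stiffL_eq_barL_add_geoL` (the block's `SmallStrain` hypothesis); `c_H := c_H′ + c_H″`.  The non-affinity functional never reaches [COER]. -/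
theorem coerciveStiffCls_of_barExch_of_geoExch {μ₁ ν₀ η c₁ cχ₁ c₂ cχ₂ : ℝ}
    (hB : BarExchCls cls s lam ℓ μ₀ τ ϱ b₀ r_S ϱχ r₁ μ₁ η c₁ cχ₁) (hG : GeoExchCls cls s lam ℓ μ₀ τ ϱ b₀ r_S ϱχ r₁ ν₀ η c₂ cχ₂) :
    CoerciveStiffCls cls s lam ℓ μ₀ τ ϱ b₀ r_S ϱχ r₁ (μ₁ - ν₀) (c₁ + c₂) (cχ₁ + cχ₂) := by
  obtain ⟨b_H, hb, hB⟩ := hB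
  obtain ⟨g_H, hg, hG⟩ := hG
  refine ⟨b_H + g_H, add_nonneg hb hg, fun P C X β₀ k S m D σ h1 h2 hcl h3 h4 h5 h6 h7 h8 h9 h10 h11 => ?_⟩
  have H1 := hB P C X β₀ k S m D σ h1 h2 hcl h3 h4 h5 h6 h7 h8 h9 h10 h11
  have H2 := hG P C X β₀ k S m D σ h1 h2 hcl h3 h4 h5 h6 h7 h8 h9 h10 h11
  rw [stiffL_eq_barL_add_geoL h10]
  linear_combination H1 + H2

/-- The glue with UNEQUAL rates: the prestress side may use any rate `η″ ≤ η′` below the bar side's (monotonicity of [GEO♮-ᶜ] in `η`). -/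
theorem coerciveStiffCls_of_barExch_of_geoExch_le {μ₁ ν₀ η η' c₁ cχ₁ c₂ cχ₂ : ℝ} (hη : η' ≤ η)
    (hB : BarExchCls cls s lam ℓ μ₀ τ ϱ b₀ r_S ϱχ r₁ μ₁ η c₁ cχ₁) (hG : GeoExchCls cls s lam ℓ μ₀ τ ϱ b₀ r_S ϱχ r₁ ν₀ η' c₂ cχ₂) :
    CoerciveStiffCls cls s lam ℓ μ₀ τ ϱ b₀ r_S ϱχ r₁ (μ₁ - ν₀) (c₁ + c₂) (cχ₁ + cχ₂) :=
  coerciveStiffCls_of_barExch_of_geoExch hB (hG.mono le_rfl hη le_rfl le_rfl)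

-- Consistency with NODE 69 (an `example`, not a theorem: its statement IS the landed `coerciveStiffCls_of_bar_of_geo`, gate `dedup.landed`):
-- g69's glue is the `η = 0` slice of this one (by the two slice lemmas; nothing of g69 is lost).
example {μ₁ ν c₁ cχ₁ c₂ cχ₂ : ℝ}
    (hB : BarCoerciveCls cls s lam ℓ μ₀ τ ϱ b₀ r_S ϱχ r₁ μ₁ c₁ cχ₁) (hG : GeoStiffCls cls s lam ℓ μ₀ τ ϱ b₀ r_S ϱχ r₁ ν c₂ cχ₂) :
    CoerciveStiffCls cls s lam ℓ μ₀ τ ϱ b₀ r_S ϱχ r₁ (μ₁ - ν) (c₁ + c₂) (cχ₁ + cχ₂) :=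
  coerciveStiffCls_of_barExch_of_geoExch (barExchCls_zero_iff.2 hB) (geoExchCls_zero_iff.2 hG)

/-! ### Sanity instances: the exchange term cannot ring the rotation / affine alarms -/

/-- SANITY (BAR♮ side): at EVERY reference, with EVERY excision `X`, NO seams, the conclusion of [BAR♮-ᶜ] holds for the rotation cocycle with EVERY
`μ₁`, EVERY `η` and all `c_T, cχ, c_H ≥ 0` (`springL`, `nonAffL` and `barL` all vanish). -/
theorem barExch_conclusion_rotField {P : PeriodicConfiguration 3} (X : Set E3) (ϱχ : ℝ) {m : ℕ} (D : Fin m → Set E3) (σ : Fin m → Bool)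
    {c_T cχ c_H : ℝ} (hT : 0 ≤ c_T) (hχ : 0 ≤ cχ) (hH : 0 ≤ c_H) (μ₁ η r₁ ϱ : ℝ) (C : Set E3) (S : Fin 0 → CutPiece) (r₀ v : E3) :
    μ₁ * springL ϱχ D σ (volterraField P S (rotField r₀ v)) P X r₁ ϱ C +
            η * nonAffL ϱχ D σ (volterraField P S (rotField r₀ v)) P X r₁ ϱ C -
          c_T * shellMassL ϱχ D σ P X ϱ C - cχ * transMassL ϱχ D σ P X ϱ C - c_H * (pricedNearCountL ϱχ D σ P X ϱ C : ℝ) ≤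
      barL ϱχ D σ (volterraField P S (rotField r₀ v)) P X ϱ C := by
  rw [volterraField_fin_zero, springL_rotField, nonAffL_rotField, barL_rotField, mul_zero, mul_zero]
  have h1 := shellMassL_nonneg (ϱχ := ϱχ) (D := D) (σ := σ) P X ϱ C
  have h2 := transMassL_nonneg (ϱχ := ϱχ) (D := D) (σ := σ) P X ϱ C
  have h3 : (0 : ℝ) ≤ (pricedNearCountL ϱχ D σ P X ϱ C : ℝ) := Nat.cast_nonneg _
  nlinarith [mul_nonneg hT h1, mul_nonneg hχ h2, mul_nonneg hH h3]

/-- SANITY (GEO♮ side, rotations): at every SITE-stress-free reference, NO excision, NO seams, the conclusion of [GEO♮-ᶜ] holds for the rotation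
cocycle with EVERY `ν₀`, EVERY `η` and all `c_T, cχ, c_H ≥ 0`. -/
theorem geoExch_conclusion_rotField {P : PeriodicConfiguration 3} (hS : IsSiteStressFree P) (ϱχ : ℝ) {m : ℕ} (D : Fin m → Set E3)
    (σ : Fin m → Bool) {c_T cχ c_H : ℝ} (hT : 0 ≤ c_T) (hχ : 0 ≤ cχ) (hH : 0 ≤ c_H) (ν₀ η r₁ ϱ : ℝ) (C : Set E3) (S : Fin 0 → CutPiece)
    (r₀ v : E3) :
    -(ν₀ * springL ϱχ D σ (volterraField P S (rotField r₀ v)) P ∅ r₁ ϱ C) -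
            η * nonAffL ϱχ D σ (volterraField P S (rotField r₀ v)) P ∅ r₁ ϱ C -
          c_T * shellMassL ϱχ D σ P ∅ ϱ C - cχ * transMassL ϱχ D σ P ∅ ϱ C - c_H * (pricedNearCountL ϱχ D σ P ∅ ϱ C : ℝ) ≤
      geoL ϱχ D σ (volterraField P S (rotField r₀ v)) P ∅ ϱ C := by
  rw [volterraField_fin_zero, springL_rotField, nonAffL_rotField, geoL_rotField_empty hS, mul_zero, mul_zero, neg_zero]
  have h1 := shellMassL_nonneg (ϱχ := ϱχ) (D := D) (σ := σ) P ∅ ϱ C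
  have h2 := transMassL_nonneg (ϱχ := ϱχ) (D := D) (σ := σ) P ∅ ϱ C
  have h3 : (0 : ℝ) ≤ (pricedNearCountL ϱχ D σ P ∅ ϱ C : ℝ) := Nat.cast_nonneg _
  nlinarith [mul_nonneg hT h1, mul_nonneg hχ h2, mul_nonneg hH h3]

/-- SANITY (GEO♮ side, AFFINE fields): at every SITE-stress-free reference, NO excision, NO seams, the conclusion of [GEO♮-ᶜ] holds for EVERY affine
field with every `ν₀ ≥ 0`, EVERY `η` and all `c_T, cχ, c_H ≥ 0` (`geoL = 0` by the kernel property, `nonAffL = 0`, the pivot is non-negative). -/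
theorem geoExch_conclusion_affineField {P : PeriodicConfiguration 3} (hS : IsSiteStressFree P) (ϱχ : ℝ) {m : ℕ} (D : Fin m → Set E3)
    (σ : Fin m → Bool) {ν₀ c_T cχ c_H : ℝ} (hν : 0 ≤ ν₀) (hT : 0 ≤ c_T) (hχ : 0 ≤ cχ) (hH : 0 ≤ c_H) (η r₁ ϱ : ℝ) (C : Set E3)
    (S : Fin 0 → CutPiece) (A : E3 →ₗ[ℝ] E3) :
    -(ν₀ * springL ϱχ D σ (volterraField P S (affineField A)) P ∅ r₁ ϱ C) -
            η * nonAffL ϱχ D σ (volterraField P S (affineField A)) P ∅ r₁ ϱ C -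
          c_T * shellMassL ϱχ D σ P ∅ ϱ C - cχ * transMassL ϱχ D σ P ∅ ϱ C - c_H * (pricedNearCountL ϱχ D σ P ∅ ϱ C : ℝ) ≤
      geoL ϱχ D σ (volterraField P S (affineField A)) P ∅ ϱ C := by
  rw [volterraField_fin_zero, geoL_affineField_empty hS, nonAffL_affineField, mul_zero, sub_zero]
  have h0 := springL_nonneg (affineField A) P ∅ r₁ (ϱχ := ϱχ) (D := D) (σ := σ) ϱ C
  have h1 := shellMassL_nonneg (ϱχ := ϱχ) (D := D) (σ := σ) P ∅ ϱ C
  have h2 := transMassL_nonneg (ϱχ := ϱχ) (D := D) (σ := σ) P ∅ ϱ C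
  have h3 : (0 : ℝ) ≤ (pricedNearCountL ϱχ D σ P ∅ ϱ C : ℝ) := Nat.cast_nonneg _
  nlinarith [mul_nonneg hν h0, mul_nonneg hT h1, mul_nonneg hχ h2, mul_nonneg hH h3]

/-- SANITY (BAR♮ side, AFFINE fields): on an affine field the exchange term vanishes, so the conclusion of [BAR♮-ᶜ] IS that of [BAR-ᶜ] — the affine
stability of the class ([A-i], census (T)/(C11)) is asked of the bar piece EXACTLY as in NODE 69, no more. -/
theorem barExch_conclusion_affineField_iff {P : PeriodicConfiguration 3} (X : Set E3) (ϱχ : ℝ) {m : ℕ} (D : Fin m → Set E3)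
    (σ : Fin m → Bool) (μ₁ η c_T cχ c_H r₁ ϱ : ℝ) (C : Set E3) (S : Fin 0 → CutPiece) (A : E3 →ₗ[ℝ] E3) :
    μ₁ * springL ϱχ D σ (volterraField P S (affineField A)) P X r₁ ϱ C +
              η * nonAffL ϱχ D σ (volterraField P S (affineField A)) P X r₁ ϱ C -
            c_T * shellMassL ϱχ D σ P X ϱ C - cχ * transMassL ϱχ D σ P X ϱ C - c_H * (pricedNearCountL ϱχ D σ P X ϱ C : ℝ) ≤
        barL ϱχ D σ (volterraField P S (affineField A)) P X ϱ C ↔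
      μ₁ * springL ϱχ D σ (volterraField P S (affineField A)) P X r₁ ϱ C -
            c_T * shellMassL ϱχ D σ P X ϱ C - cχ * transMassL ϱχ D σ P X ϱ C - c_H * (pricedNearCountL ϱχ D σ P X ϱ C : ℝ) ≤
        barL ϱχ D σ (volterraField P S (affineField A)) P X ϱ C := by
  rw [volterraField_fin_zero, nonAffL_affineField, mul_zero, add_zero]

end Glue

/-! ## §X4 The Korn corner (g69's target 3, typed THROUGH the exchange — the lossy route, recorded, not designated) -/

section Korn

variable (cls : Set E3 → Prop) (s lam ℓ μ₀ τ ϱ b₀ r_S ϱχ r₁ : ℝ)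

/-- piece [KORN-ᶜ](`C_K, c_T, cχ, r₁`) · **DISCRETE KORN INEQUALITY FOR THE CLASS**: over the hypothesis block VERBATIM, the weighted non-affinity is
at most `C_K` times the pivot plus currencies, `nonAffL(β) ≤ C_K·springL(β) + c_T·M_sh + cχ·M_tr + c_H·N_pr` — a finite cluster-truss rigidity
certificate (octet-truss chunks of two nn-graph steps are first-order rigid with flexes ⊂ affine fields; the bare cuboctahedral star is NOT —
jitterbug) plus weight-ratio bookkeeping.  CERT-like · ATTACKABLE-S.  Floats: `max_k N/λ_min(S) = 6.00` fcc (L point), `6.66` hcp (optical Γ). -/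
def NonAffKornCls (C_K c_T cχ : ℝ) : Prop :=
  ∃ c_H : ℝ, 0 ≤ c_H ∧ ∀ (P : PeriodicConfiguration 3) (C X : Set E3) (β₀ : E3 → E3 → E3) (k : ℕ) (S : Fin k → CutPiece)
    (m : ℕ) (D : Fin m → Set E3) (σ : Fin m → Bool),
    IsSeparatedRef s P → IsLabelledRef lam ℓ P → cls P.points → IsForceFree P → IsSiteStressFree P → HarmStableModRot μ₀ P →
    IsInvariantSet P C → IsInvariantSet P X → IsGlobalCocycle P β₀ → IsSeamSystem b₀ r_S P S →
    SmallStrain τ P X (volterraField P S β₀) → (∀ i, IsInvariantSet P (D i)) →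
      nonAffL ϱχ D σ (volterraField P S β₀) P X r₁ ϱ C ≤
        C_K * springL ϱχ D σ (volterraField P S β₀) P X r₁ ϱ C + c_T * shellMassL ϱχ D σ P X ϱ C + cχ * transMassL ϱχ D σ P X ϱ C +
          c_H * (pricedNearCountL ϱχ D σ P X ϱ C : ℝ)

variable {cls s lam ℓ μ₀ τ ϱ b₀ r_S ϱχ r₁}

/-- The Korn corner, prestress side = g69's target 3 «[GEO] ⟸ [GEO-grad] ∧ [KORN-loc]» TYPED: [GEO♮-ᶜ](`ν₀, η, c′`) ∧ [KORN-ᶜ](`C_K, c″`) ⟹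
[GEO-ᶜ](`ν₀ + η·C_K, c′ + η·c″`) for `η ≥ 0`.  LOSSY (floats: `ν₀ + η·C_K ≈ 0.39 | 0.37` at the designate rates vs the direct prestress ceiling
`0.23 | 0.26`) — which is WHY the node charges `η·N` to the bar form directly instead (its slack sits at the same short waves where `N/S` peaks). -/
theorem geoStiffCls_of_geoExch_of_korn {ν₀ η C_K c₁ cχ₁ c₂ cχ₂ : ℝ} (hη : 0 ≤ η)
    (hG : GeoExchCls cls s lam ℓ μ₀ τ ϱ b₀ r_S ϱχ r₁ ν₀ η c₁ cχ₁) (hK : NonAffKornCls cls s lam ℓ μ₀ τ ϱ b₀ r_S ϱχ r₁ C_K c₂ cχ₂) :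
    GeoStiffCls cls s lam ℓ μ₀ τ ϱ b₀ r_S ϱχ r₁ (ν₀ + η * C_K) (c₁ + η * c₂) (cχ₁ + η * cχ₂) := by
  obtain ⟨g_H, hg, hG⟩ := hG
  obtain ⟨k_H, hk, hK⟩ := hK
  refine ⟨g_H + η * k_H, add_nonneg hg (mul_nonneg hη hk), fun P C X β₀ k S m D σ h1 h2 hcl h3 h4 h5 h6 h7 h8 h9 h10 h11 => ?_⟩
  have H1 := hG P C X β₀ k S m D σ h1 h2 hcl h3 h4 h5 h6 h7 h8 h9 h10 h11
  have H2 := hK P C X β₀ k S m D σ h1 h2 hcl h3 h4 h5 h6 h7 h8 h9 h10 h11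
  nlinarith [mul_le_mul_of_nonneg_left H2 hη]

/-- The Korn corner, bar side: [BAR-ᶜ](`μ₁ + η·C_K, c′`) ∧ [KORN-ᶜ](`C_K, c″`) ⟹ [BAR♮-ᶜ](`μ₁, η, c′ + η·c″`) for `η ≥ 0` (LOSSY the same way:
it spends bar modulus `η·C_K ≈ 0.24 | 0.17` uniformly, although the bar form's slack over the pivot is short-wave). -/
theorem barExchCls_of_bar_of_korn {μ₁ η C_K c₁ cχ₁ c₂ cχ₂ : ℝ} (hη : 0 ≤ η)
    (hB : BarCoerciveCls cls s lam ℓ μ₀ τ ϱ b₀ r_S ϱχ r₁ (μ₁ + η * C_K) c₁ cχ₁) (hK : NonAffKornCls cls s lam ℓ μ₀ τ ϱ b₀ r_S ϱχ r₁ C_K c₂ cχ₂) :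
    BarExchCls cls s lam ℓ μ₀ τ ϱ b₀ r_S ϱχ r₁ μ₁ η (c₁ + η * c₂) (cχ₁ + η * cχ₂) := by
  obtain ⟨b_H, hb, hB⟩ := hB
  obtain ⟨k_H, hk, hK⟩ := hK
  refine ⟨b_H + η * k_H, add_nonneg hb (mul_nonneg hη hk), fun P C X β₀ k S m D σ h1 h2 hcl h3 h4 h5 h6 h7 h8 h9 h10 h11 => ?_⟩
  have H1 := hB P C X β₀ k S m D σ h1 h2 hcl h3 h4 h5 h6 h7 h8 h9 h10 h11
  have H2 := hK P C X β₀ k S m D σ h1 h2 hcl h3 h4 h5 h6 h7 h8 h9 h10 h11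
  nlinarith [mul_le_mul_of_nonneg_left H2 hη]

end Korn

/-! ## §X5 ★★ Record cones (R5) -/

section Record

variable {cls : Set E3 → Prop}

/-- ★ (R5), PARAMETRIC, one class: at the record dials, for ANY `(μ₁, ν₀, η, r₁)` and any admissible split of the two budgets, [LOAD-ᶜ](`(μ₁ − ν₀)/2`)
∧ [BAR♮-ᶜ](`μ₁, η, c′`) ∧ [GEO♮-ᶜ](`ν₀, η, c″`) ⟹ (H𝄪ᶜ) AT THE RECORD (through NODE 68's `localSeamTransferBoundCls_record_of_load_of_coercive`). -/
theorem localSeamTransferBoundCls_record_of_load_barExch_geoExch {μ₁ ν₀ η A_T Aχ c₁ cχ₁ c₂ cχ₂ r₁ : ℝ}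
    (hT : A_T + 1 / 2 * (c₁ + c₂) ≤ 1 / 3000000) (hχ : Aχ + 1 / 2 * (cχ₁ + cχ₂) ≤ 1 / 100000)
    (hL : LoadBoundCls cls (3 / 5) (1 / 3) 3 (1 / 100) (3 / 100) 160 (2 / 5) 3 80 r₁ (1 / 2 * (μ₁ - ν₀)) A_T Aχ)
    (hB : BarExchCls cls (3 / 5) (1 / 3) 3 (1 / 100) (3 / 100) 160 (2 / 5) 3 80 r₁ μ₁ η c₁ cχ₁)
    (hG : GeoExchCls cls (3 / 5) (1 / 3) 3 (1 / 100) (3 / 100) 160 (2 / 5) 3 80 r₁ ν₀ η c₂ cχ₂) :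
    LocalSeamTransferBoundCls cls (3 / 5) (1 / 3) 3 (1 / 100) (3 / 100) (1 / 2) 160 (2 / 5) 3 (1 / 3000000) 80 (1 / 100000) :=
  localSeamTransferBoundCls_record_of_load_of_coercive hT hχ hL (coerciveStiffCls_of_barExch_of_geoExch hB hG)

/-- The DESIGNATE arithmetic: `33/20 − 3/20 = 3/2 = 17/10 − 1/5` (NODE 68's `μ`, so its LOAD designate `t = 3/4` stands; the halved currencies are
NODE 69's, `record_stressSplit_budget`). -/
theorem record_exchange_budget : (33 / 20 : ℝ) - 3 / 20 = 3 / 2 ∧ (17 / 10 : ℝ) - 1 / 5 = 3 / 2 := by norm_num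

/-- ★ fcc DESIGNATE of the exchange: [BAR♮-ᶜ](`33/20, 1/25`) ∧ [GEO♮-ᶜ](`3/20, 1/25`) at the halved currencies ⟹ [COER-ᶜ] at NODE 68's designate
(any class `cls`; used at `IsFccImage`; floats: `μ₁` margin `9 %`, `η`-window `[0.016, 0.112] ∋ 0.04`). -/
theorem coerciveStiffCls_designateF_of_barExch_of_geoExch
    (hB : BarExchCls cls (3 / 5) (1 / 3) 3 (1 / 100) (3 / 100) 160 (2 / 5) 3 80 (6 / 5) (33 / 20) (1 / 25) (1 / 30000000) (1 / 1000000))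
    (hG : GeoExchCls cls (3 / 5) (1 / 3) 3 (1 / 100) (3 / 100) 160 (2 / 5) 3 80 (6 / 5) (3 / 20) (1 / 25) (1 / 30000000) (1 / 1000000)) :
    CoerciveStiffCls cls (3 / 5) (1 / 3) 3 (1 / 100) (3 / 100) 160 (2 / 5) 3 80 (6 / 5) (3 / 2) (1 / 15000000) (1 / 500000) := by
  have h := coerciveStiffCls_of_barExch_of_geoExch hB hG
  rw [record_exchange_budget.1, record_stressSplit_budget.2.2.1, record_stressSplit_budget.2.2.2] at h
  exact h

/-- ★ hcp DESIGNATE of the exchange: [BAR♮-ᶜ](`17/10, 1/40`) ∧ [GEO♮-ᶜ](`1/5, 1/40`) at the halved currencies ⟹ [COER-ᶜ] at NODE 68's designate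
(any class `cls`; used at `IsHcpImage`; floats: `μ₁` margin `14 %`, `η`-window `[0.010, 0.053] ∋ 0.025`). -/
theorem coerciveStiffCls_designateH_of_barExch_of_geoExch
    (hB : BarExchCls cls (3 / 5) (1 / 3) 3 (1 / 100) (3 / 100) 160 (2 / 5) 3 80 (6 / 5) (17 / 10) (1 / 40) (1 / 30000000) (1 / 1000000))
    (hG : GeoExchCls cls (3 / 5) (1 / 3) 3 (1 / 100) (3 / 100) 160 (2 / 5) 3 80 (6 / 5) (1 / 5) (1 / 40) (1 / 30000000) (1 / 1000000)) :
    CoerciveStiffCls cls (3 / 5) (1 / 3) 3 (1 / 100) (3 / 100) 160 (2 / 5) 3 80 (6 / 5) (3 / 2) (1 / 15000000) (1 / 500000) := by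
  have h := coerciveStiffCls_of_barExch_of_geoExch hB hG
  rw [record_exchange_budget.2, record_stressSplit_budget.2.2.1, record_stressSplit_budget.2.2.2] at h
  exact h

/-- ★★ **THE MAX-COVER RECORD CONE OF GENERATION 70, PARAMETRIC**: `ChargeRecount · IP_G · FCP_G · CCP_G · REG-BALL_M · LABEL_M · SHELL-BUDGET_M(10⁵) ·
[LOAD-ᶠ] · [BAR♮-ᶠ] · [GEO♮-ᶠ] · [LOAD-ʰ] · [BAR♮-ʰ] · [GEO♮-ʰ] · LOCAL-REDUCTIONᶠʰ_M · P_G ⟹ ChargedEnergyGap` at `ϱ = 160`, for every admissible budget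
split and every `(μ₁, ν₀, η, r₁)` per class (through NODE 68's `chargedEnergyGap_of_maxCoverCascade_record` and the glue). -/
theorem chargedEnergyGap_of_maxCoverExchange_record (hF : ChargeRecount)
    (hIP : ImprovablePricingG (3 / 20) (1 / 10) (6 / 5) 10 (1 / 100) (3 / 5))
    (hFCP : FrustratedCorePricingG (3 / 20) (1 / 10) (6 / 5) 10 (1 / 100) 40 (3 / 5))
    (hCCP : CoherentCorePricingG (3 / 20) (1 / 10) (6 / 5) 10 (1 / 100) 40 (1 / 10) 40 (3 / 5))
    (hB : CoreBallRegularPricingW (maxCoverWeights (3 / 20) (1 / 10) (6 / 5) 10 (1 / 100) 40 (1 / 10) 40 160) (1 / 20) (3 / 5) 10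
      fun _ _ => True)
    (hLab : CleanLabellingW (maxCoverWeights (3 / 20) (1 / 10) (6 / 5) 10 (1 / 100) 40 (1 / 10) 40 160) (3 / 5) 10 (1 / 3) 3)
    (hSB : ShellBudgetW (maxCoverWeights (3 / 20) (1 / 10) (6 / 5) 10 (1 / 100) 40 (1 / 10) 40 160) (3 / 5) 100000)
    {μf νf ηf Af Aχf cf cχf cf' cχf' rf μh νh ηh Ah Aχh ch cχh ch' cχh' rh : ℝ}
    (hTf : Af + 1 / 2 * (cf + cf') ≤ 1 / 3000000) (hχf : Aχf + 1 / 2 * (cχf + cχf') ≤ 1 / 100000)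
    (hTh : Ah + 1 / 2 * (ch + ch') ≤ 1 / 3000000) (hχh : Aχh + 1 / 2 * (cχh + cχh') ≤ 1 / 100000)
    (hLf : LoadBoundCls IsFccImage (3 / 5) (1 / 3) 3 (1 / 100) (3 / 100) 160 (2 / 5) 3 80 rf (1 / 2 * (μf - νf)) Af Aχf)
    (hBf : BarExchCls IsFccImage (3 / 5) (1 / 3) 3 (1 / 100) (3 / 100) 160 (2 / 5) 3 80 rf μf ηf cf cχf)
    (hGf : GeoExchCls IsFccImage (3 / 5) (1 / 3) 3 (1 / 100) (3 / 100) 160 (2 / 5) 3 80 rf νf ηf cf' cχf')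
    (hLh : LoadBoundCls IsHcpImage (3 / 5) (1 / 3) 3 (1 / 100) (3 / 100) 160 (2 / 5) 3 80 rh (1 / 2 * (μh - νh)) Ah Aχh)
    (hBh : BarExchCls IsHcpImage (3 / 5) (1 / 3) 3 (1 / 100) (3 / 100) 160 (2 / 5) 3 80 rh μh ηh ch cχh)
    (hGh : GeoExchCls IsHcpImage (3 / 5) (1 / 3) 3 (1 / 100) (3 / 100) 160 (2 / 5) 3 80 rh νh ηh ch' cχh')
    (hN : LocalSeamReductionFH (3 / 5) (1 / 3) 3 (1 / 100) (3 / 100) (1 / 2) 160 (2 / 5) 3 (1 / 3000000) 80 (1 / 100000)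
      (maxCoverWeights (3 / 20) (1 / 10) (6 / 5) 10 (1 / 100) 40 (1 / 10) 40 160) (1 / 20) 10 100000)
    (hP : ChartedChargePricingG (3 / 20) (1 / 10) (3 / 5)) : ChargedEnergyGap :=
  chargedEnergyGap_of_maxCoverCascade_record hF hIP hFCP hCCP hB hLab hSB hTf hχf hTh hχh hLf (coerciveStiffCls_of_barExch_of_geoExch hBf hGf)
    hLh (coerciveStiffCls_of_barExch_of_geoExch hBh hGh) hN hP

/-- ★ **THE RECORD-DESIGNATE OF GENERATION 70** — FOURTEEN LEAVES: 7 record leaves · [LOAD-ᶠ](`3/4; 3/10⁷, 9/10⁶`) · [BAR♮-ᶠ](`33/20, 1/25`) ·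
[GEO♮-ᶠ](`3/20, 1/25`) · [LOAD-ʰ] · [BAR♮-ʰ](`17/10, 1/40`) · [GEO♮-ʰ](`1/5, 1/40`) (currencies `(1/(30·10⁶), 10⁻⁶)` each, `r₁ = 6/5`) · (N𝄪ᶠʰ) · P_G ⟹
ChargedEnergyGap (through NODE 68's designate cone). -/
theorem chargedEnergyGap_of_maxCoverExchange_designate (hF : ChargeRecount)
    (hIP : ImprovablePricingG (3 / 20) (1 / 10) (6 / 5) 10 (1 / 100) (3 / 5))
    (hFCP : FrustratedCorePricingG (3 / 20) (1 / 10) (6 / 5) 10 (1 / 100) 40 (3 / 5))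
    (hCCP : CoherentCorePricingG (3 / 20) (1 / 10) (6 / 5) 10 (1 / 100) 40 (1 / 10) 40 (3 / 5))
    (hB : CoreBallRegularPricingW (maxCoverWeights (3 / 20) (1 / 10) (6 / 5) 10 (1 / 100) 40 (1 / 10) 40 160) (1 / 20) (3 / 5) 10
      fun _ _ => True)
    (hLab : CleanLabellingW (maxCoverWeights (3 / 20) (1 / 10) (6 / 5) 10 (1 / 100) 40 (1 / 10) 40 160) (3 / 5) 10 (1 / 3) 3)
    (hSB : ShellBudgetW (maxCoverWeights (3 / 20) (1 / 10) (6 / 5) 10 (1 / 100) 40 (1 / 10) 40 160) (3 / 5) 100000)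
    (hLf : LoadBoundCls IsFccImage (3 / 5) (1 / 3) 3 (1 / 100) (3 / 100) 160 (2 / 5) 3 80 (6 / 5) (3 / 4) (3 / 10000000) (9 / 1000000))
    (hBf : BarExchCls IsFccImage (3 / 5) (1 / 3) 3 (1 / 100) (3 / 100) 160 (2 / 5) 3 80 (6 / 5) (33 / 20) (1 / 25) (1 / 30000000)
      (1 / 1000000))
    (hGf : GeoExchCls IsFccImage (3 / 5) (1 / 3) 3 (1 / 100) (3 / 100) 160 (2 / 5) 3 80 (6 / 5) (3 / 20) (1 / 25) (1 / 30000000)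
      (1 / 1000000))
    (hLh : LoadBoundCls IsHcpImage (3 / 5) (1 / 3) 3 (1 / 100) (3 / 100) 160 (2 / 5) 3 80 (6 / 5) (3 / 4) (3 / 10000000) (9 / 1000000))
    (hBh : BarExchCls IsHcpImage (3 / 5) (1 / 3) 3 (1 / 100) (3 / 100) 160 (2 / 5) 3 80 (6 / 5) (17 / 10) (1 / 40) (1 / 30000000)
      (1 / 1000000))
    (hGh : GeoExchCls IsHcpImage (3 / 5) (1 / 3) 3 (1 / 100) (3 / 100) 160 (2 / 5) 3 80 (6 / 5) (1 / 5) (1 / 40) (1 / 30000000)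
      (1 / 1000000))
    (hN : LocalSeamReductionFH (3 / 5) (1 / 3) 3 (1 / 100) (3 / 100) (1 / 2) 160 (2 / 5) 3 (1 / 3000000) 80 (1 / 100000)
      (maxCoverWeights (3 / 20) (1 / 10) (6 / 5) 10 (1 / 100) 40 (1 / 10) 40 160) (1 / 20) 10 100000)
    (hP : ChartedChargePricingG (3 / 20) (1 / 10) (3 / 5)) : ChargedEnergyGap :=
  chargedEnergyGap_of_maxCoverCascade_designate hF hIP hFCP hCCP hB hLab hSB hLf (coerciveStiffCls_designateF_of_barExch_of_geoExch hBf hGf) hLh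
    (coerciveStiffCls_designateH_of_barExch_of_geoExch hBh hGh) hN hP

/-- POPULATED INSTANCE (BAR♮ side) at the fcc witness of the hypothesis block: the fcc DESIGNATE conclusion of [BAR♮-ᶠ] (`μ₁ = 33/20`, `η = 1/25`,
currencies `(1/(30·10⁶), 10⁻⁶)`, any `c_H ≥ 0`) holds for every rotation cocycle, with EVERY excision, no seams. -/
theorem fcc_barExch_rotInstance_designate {c_H : ℝ} (hH : 0 ≤ c_H) (X : Set E3) (ϱχ : ℝ) {m : ℕ} (D : Fin m → Set E3) (σ : Fin m → Bool)
    (ϱ : ℝ) (C : Set E3) (S : Fin 0 → CutPiece) (r₀ v : E3) :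
    (33 / 20 : ℝ) * springL ϱχ D σ (volterraField (Fcc.fccRef Fcc.a0 Fcc.a0_pos) S (rotField r₀ v)) (Fcc.fccRef Fcc.a0 Fcc.a0_pos) X (6 / 5) ϱ C +
              (1 / 25 : ℝ) * nonAffL ϱχ D σ (volterraField (Fcc.fccRef Fcc.a0 Fcc.a0_pos) S (rotField r₀ v)) (Fcc.fccRef Fcc.a0 Fcc.a0_pos) X
                (6 / 5) ϱ C -
            (1 / 30000000 : ℝ) * shellMassL ϱχ D σ (Fcc.fccRef Fcc.a0 Fcc.a0_pos) X ϱ C -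
          (1 / 1000000 : ℝ) * transMassL ϱχ D σ (Fcc.fccRef Fcc.a0 Fcc.a0_pos) X ϱ C -
        c_H * (pricedNearCountL ϱχ D σ (Fcc.fccRef Fcc.a0 Fcc.a0_pos) X ϱ C : ℝ) ≤
      barL ϱχ D σ (volterraField (Fcc.fccRef Fcc.a0 Fcc.a0_pos) S (rotField r₀ v)) (Fcc.fccRef Fcc.a0 Fcc.a0_pos) X ϱ C :=
  barExch_conclusion_rotField X ϱχ D σ (by norm_num) (by norm_num) hH (33 / 20) (1 / 25) (6 / 5) ϱ C S r₀ v

/-- POPULATED INSTANCE (GEO♮ side, rotations) at the fcc witness: the fcc DESIGNATE conclusion of [GEO♮-ᶠ] (`ν₀ = 3/20`, `η = 1/25`) holds for every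
rotation cocycle, no excision, no seams (`Fcc.isSiteStressFree_fcc`). -/
theorem fcc_geoExch_rotInstance_designate {c_H : ℝ} (hH : 0 ≤ c_H) (ϱχ : ℝ) {m : ℕ} (D : Fin m → Set E3) (σ : Fin m → Bool) (ϱ : ℝ)
    (C : Set E3) (S : Fin 0 → CutPiece) (r₀ v : E3) :
    -((3 / 20 : ℝ) * springL ϱχ D σ (volterraField (Fcc.fccRef Fcc.a0 Fcc.a0_pos) S (rotField r₀ v)) (Fcc.fccRef Fcc.a0 Fcc.a0_pos) ∅ (6 / 5) ϱ C) -
              (1 / 25 : ℝ) * nonAffL ϱχ D σ (volterraField (Fcc.fccRef Fcc.a0 Fcc.a0_pos) S (rotField r₀ v)) (Fcc.fccRef Fcc.a0 Fcc.a0_pos) ∅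
                (6 / 5) ϱ C -
            (1 / 30000000 : ℝ) * shellMassL ϱχ D σ (Fcc.fccRef Fcc.a0 Fcc.a0_pos) ∅ ϱ C -
          (1 / 1000000 : ℝ) * transMassL ϱχ D σ (Fcc.fccRef Fcc.a0 Fcc.a0_pos) ∅ ϱ C -
        c_H * (pricedNearCountL ϱχ D σ (Fcc.fccRef Fcc.a0 Fcc.a0_pos) ∅ ϱ C : ℝ) ≤
      geoL ϱχ D σ (volterraField (Fcc.fccRef Fcc.a0 Fcc.a0_pos) S (rotField r₀ v)) (Fcc.fccRef Fcc.a0 Fcc.a0_pos) ∅ ϱ C :=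
  geoExch_conclusion_rotField Fcc.isSiteStressFree_fcc ϱχ D σ (by norm_num) (by norm_num) hH (3 / 20) (1 / 25) (6 / 5) ϱ C S r₀ v

/-- POPULATED INSTANCE (GEO♮ side, affine fields) at the fcc witness: the fcc DESIGNATE conclusion of [GEO♮-ᶠ] holds for EVERY affine field, no
excision, no seams. -/
theorem fcc_geoExch_affineInstance_designate {c_H : ℝ} (hH : 0 ≤ c_H) (ϱχ : ℝ) {m : ℕ} (D : Fin m → Set E3) (σ : Fin m → Bool) (ϱ : ℝ)
    (C : Set E3) (S : Fin 0 → CutPiece) (A : E3 →ₗ[ℝ] E3) :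
    -((3 / 20 : ℝ) * springL ϱχ D σ (volterraField (Fcc.fccRef Fcc.a0 Fcc.a0_pos) S (affineField A)) (Fcc.fccRef Fcc.a0 Fcc.a0_pos) ∅ (6 / 5) ϱ C) -
              (1 / 25 : ℝ) * nonAffL ϱχ D σ (volterraField (Fcc.fccRef Fcc.a0 Fcc.a0_pos) S (affineField A)) (Fcc.fccRef Fcc.a0 Fcc.a0_pos) ∅
                (6 / 5) ϱ C -
            (1 / 30000000 : ℝ) * shellMassL ϱχ D σ (Fcc.fccRef Fcc.a0 Fcc.a0_pos) ∅ ϱ C -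
          (1 / 1000000 : ℝ) * transMassL ϱχ D σ (Fcc.fccRef Fcc.a0 Fcc.a0_pos) ∅ ϱ C -
        c_H * (pricedNearCountL ϱχ D σ (Fcc.fccRef Fcc.a0 Fcc.a0_pos) ∅ ϱ C : ℝ) ≤
      geoL ϱχ D σ (volterraField (Fcc.fccRef Fcc.a0 Fcc.a0_pos) S (affineField A)) (Fcc.fccRef Fcc.a0 Fcc.a0_pos) ∅ ϱ C :=
  geoExch_conclusion_affineField Fcc.isSiteStressFree_fcc ϱχ D σ (by norm_num) (by norm_num) (by norm_num) hH (1 / 25) (6 / 5) ϱ C S A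

end Record

end Summit.AtomisticToContinuum.Crystallization.Theorems.ChargedEnergyGapChartDial
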